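import Summits.CriticalPhenomena.PercolationContinuityZ3.Theorems.PercNearOneGluingNoHeavyLowerTailPocketCSHDefs
import Summits.CriticalPhenomena.PercolationContinuityZ3.Theorems.PercNearOneGluingNoHeavyLowerTailKNConj4PreMargin
import Summits.CriticalPhenomena.PercolationContinuityZ3.Theorems.PercNearOneGluingNoHeavyLowerTailKnQuestion8TwoRelays
import HarnessLib

/-!
# Kozma–Nitzan's Question 8 for EVERY relay set from the pocket conditioned slack hierarchy (the pocket pre-FKG peeling)

Support file (`--supports stmt-CriticalPhenomena-4575`, closed crux; independent mathematics), prover `prim-ineq-gen-7` (gen 10).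
Memo `run/shared/lean/prim/prim-ineq-gen-7/FINDING-Q8-POCKET-g10.md` §3.  No definitions, no named facts, no sorries; standard axioms.

Kozma–Nitzan (arXiv:2401.12397, §5.5 p. 36), QUESTION 8: designate `c ∈ A` by the score `P(a ↔ b, 0 ↮ A)`; does (41)
`P(0 ↔ b, 0 ↔ A) ≥ P(0 ↔ A, c ↔ b)` hold?  In the tree: `|A| ≤ 2` (`KnQ8.knQuestion8_pair`, prim-lf-2), `|A| = 3` reduced to two named
one-cluster inequalities (`PocketCert.block41_three_of_pcovZ`, prim-lf-2).  THIS FILE reduces EVERY `|A|` (and every decreasing pocket event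
`P = {C_0 ∈ 𝒟}`, every monotone functional `F`) to the POCKET conditioned slack hierarchy `PocketCSH.PCSHHolds` (`…PocketCSHDefs.lean`),
exactly as `PreFKGSurplus.preMargin_nonneg_of_csh` reduced Question 7 / Conjecture 4 to `CSH.CSHHolds` and `MixCSH.kn_question9_of_mixCSH`
reduced Question 9 to the hub hierarchy:

* `PocketCSH.preMargin_nonneg_of_pcsh` — with `Δ_o(X) := ∫_{o↔X} (F(C o) − F(C c))` at the label `o` and the POCKET-RESTRICTED
  `Δ^P_u(X) := ∫_{P ∩ {u↔X}} (F(C u) − F(C c))` at every other label (`c ∈ X` the pocket designee: `∫_P F(C c) ≤ ∫_P F(C a)` for all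
  `a ∈ X`), the level-form margin `Marg_{X,D}` built from the POCKET constants (`pDecoyList`, `pObsConst`) is `≥ 0` for every decoy list —
  IF `PCSHHolds` is available for every owner / avoided set / decoy list (hypothesis `hPCSH`, the shape of `hCSH` in the template).
  Proof = the template's peeling, step for step: peel `k ≠ c` (`setIntegral_iUnion_erase_add`, the peel identity inside any event); the
  peeled column is `μ(R_k)·T_k = pCovD(g_k) + J_k·(μ(R_k)·c_k)` with `R_k = {k↮X∖k} ∩ P` the reference event, `g_k = F(C k) − F(C c)` and
  `J_k = ∫_{R_k} g_k = s_k − Δ^P_k(X∖k)`, `s_k = ∫_P g_k ≥ 0` (THE ONLY USE OF THE DESIGNATION); `PCSHHolds` (i) for `g_k`; Lemma AC from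
  `PCSHHolds` (ii) at `Ψ_iso` (`pCovD(Ψ_iso) = (μ(R_k ∩ {C_k = ∅})·μ(R_k)) • c_k`); next rung `CSH.cshMarg_cons`; induction on `|X|`.
* (sequel `…PocketCSHQuestion8.lean`: the case `D = []` with a spare second observer ⇒ (41) for the pocket designee and KN Question 8 for every
  `|X|`, conditional on the pocket hierarchy.)
Weights: `w e < 1` for all pairs (the empty configuration charges every reference event; `{o} ∈ 𝒟`).
[cite: KozmaNitzan2024, Question 8 (§5.5 p. 36), Conj. 4 (p. 32)] [cite: VandenbergHaggstromKahn2005, Thm. 1.3 (p. 6)]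
-/

noncomputable section

namespace Summit.CriticalPhenomena.PercolationContinuityZ3.Theorems

open MeasureTheory Set Literature.Probability.LatticeModels Literature.Probability.Percolation
open scoped Classical
open KNPreFKG CSH PreFKGSurplus

namespace PocketCSH

variable {n : ℕ}

/-- **The peel identity inside an arbitrary event `E`.**  For `k ∈ X` and every `u`:
`∫_{E ∩ {u↔X}} (F(C u) − F(C c)) = ∫_{E ∩ {u↔X∖k}} (F(C u) − F(C c)) + ∫_{E ∩ {k↮X∖k} ∩ {k↔u}} (F(C k) − F(C c))`
(on the new part `C(u) = C(k)`). [cite: KozmaNitzan2024, Conj. 4 (p. 32)] -/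
theorem setIntegral_iUnion_erase_add (w : Sym2 (Fin n) → unitInterval) (X : Finset (Fin n)) (F : Set (Fin n) → ℝ) (c k u : Fin n)
    (hkX : k ∈ X) (E : Set (BondConfig (Fin n))) :
    ∫ ω in E ∩ ⋃ a ∈ X, openConn u a, (F (openCluster ω u) - F (openCluster ω c)) ∂(prodBernoulli w) =
      (∫ ω in E ∩ ⋃ a ∈ X.erase k, openConn u a, (F (openCluster ω u) - F (openCluster ω c)) ∂(prodBernoulli w)) +
        ∫ ω in E ∩ ({ω : BondConfig (Fin n) | ∀ a ∈ (↑(X.erase k) : Set (Fin n)), ¬ (openGraph ω).Reachable k a} ∩ openConn k u),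
          (F (openCluster ω k) - F (openCluster ω c)) ∂(prodBernoulli w) := by
  classical
  have hmeas : ∀ S : Set (BondConfig (Fin n)), MeasurableSet S := fun _ => MeasurableSet.of_discrete
  have hint : ∀ (g : BondConfig (Fin n) → ℝ), Integrable g (prodBernoulli w) := fun g => Integrable.of_finite
  set gu : BondConfig (Fin n) → ℝ := fun ω => F (openCluster ω u) - F (openCluster ω c) with hgu
  set gk : BondConfig (Fin n) → ℝ := fun ω => F (openCluster ω k) - F (openCluster ω c) with hgk
  set Dk : Set (BondConfig (Fin n)) := {ω : BondConfig (Fin n) | ∀ a ∈ (↑(X.erase k) : Set (Fin n)), ¬ (openGraph ω).Reachable k a}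
    with hDk
  have hpt : ∀ ω : BondConfig (Fin n), (E ∩ ⋃ a ∈ X, (openConn u a : Set (BondConfig (Fin n)))).indicator gu ω =
      (E ∩ ⋃ a ∈ X.erase k, (openConn u a : Set (BondConfig (Fin n)))).indicator gu ω + (E ∩ (Dk ∩ openConn k u)).indicator gk ω := by
    intro ω
    by_cases hE : ω ∈ E
    swap
    · rw [indicator_of_notMem (fun h => hE h.1), indicator_of_notMem (fun h => hE h.1), indicator_of_notMem (fun h => hE h.1),
        add_zero]
    by_cases h1 : ∃ a ∈ X.erase k, (openGraph ω).Reachable u a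
    · obtain ⟨a, ha, hua⟩ := h1
      have m1 : ω ∈ E ∩ ⋃ a ∈ X, (openConn u a : Set (BondConfig (Fin n))) :=
        ⟨hE, (mem_iUnion_openConn X u ω).2 ⟨a, Finset.mem_of_mem_erase ha, hua⟩⟩
      have m2 : ω ∈ E ∩ ⋃ a ∈ X.erase k, (openConn u a : Set (BondConfig (Fin n))) := ⟨hE, (mem_iUnion_openConn _ u ω).2 ⟨a, ha, hua⟩⟩
      have m3 : ω ∉ E ∩ (Dk ∩ openConn k u) := fun h =>
        h.2.1 a (Finset.mem_coe.2 ha) ((show (openGraph ω).Reachable k u from h.2.2).trans hua)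
      rw [indicator_of_mem m1, indicator_of_mem m2, indicator_of_notMem m3, add_zero]
    · by_cases h2 : (openGraph ω).Reachable u k
      · have m1 : ω ∈ E ∩ ⋃ a ∈ X, (openConn u a : Set (BondConfig (Fin n))) := ⟨hE, (mem_iUnion_openConn X u ω).2 ⟨k, hkX, h2⟩⟩
        have m2 : ω ∉ E ∩ ⋃ a ∈ X.erase k, (openConn u a : Set (BondConfig (Fin n))) :=
          fun h => h1 ((mem_iUnion_openConn _ u ω).1 h.2)
        have m3 : ω ∈ E ∩ (Dk ∩ openConn k u) := by
          refine ⟨hE, fun a ha hka => h1 ⟨a, Finset.mem_coe.1 ha, h2.trans hka⟩, ?_⟩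
          exact (show (openGraph ω).Reachable k u from h2.symm)
        rw [indicator_of_mem m1, indicator_of_notMem m2, indicator_of_mem m3, zero_add, hgu, hgk]
        simp only [openCluster_eq_of_reach h2]
      · have m1 : ω ∉ E ∩ ⋃ a ∈ X, (openConn u a : Set (BondConfig (Fin n))) := by
          intro h
          obtain ⟨a, ha, hua⟩ := (mem_iUnion_openConn X u ω).1 h.2
          by_cases hak : a = k
          · exact h2 (hak ▸ hua)
          · exact h1 ⟨a, Finset.mem_erase.2 ⟨hak, ha⟩, hua⟩
        have m2 : ω ∉ E ∩ ⋃ a ∈ X.erase k, (openConn u a : Set (BondConfig (Fin n))) :=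
          fun h => h1 ((mem_iUnion_openConn _ u ω).1 h.2)
        have m3 : ω ∉ E ∩ (Dk ∩ openConn k u) := fun h => h2 (show (openGraph ω).Reachable k u from h.2.2).symm
        rw [indicator_of_notMem m1, indicator_of_notMem m2, indicator_of_notMem m3, add_zero]
  rw [← integral_indicator (hmeas _), ← integral_indicator (hmeas _), ← integral_indicator (hmeas _),
    ← integral_add (hint _) (hint _)]
  exact integral_congr_ae (Filter.Eventually.of_forall hpt)

/-- **Pocket (pS5D) from PCSH — the pocket pre-FKG surplus margin is nonnegative.**  Weights `< 1`, a pocket family `𝒟 ∋ {o}`, observers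
`o, v` with the pocket hierarchy `PocketCSH.PCSHHolds` available for every owner / avoided set / decoy list (hypothesis `hPCSH`).  Then for
every relay set `X ∌ o, v`, every `c ∈ X` with `∫_P F(C c) ≤ ∫_P F(C a)` for all `a ∈ X` (`P = {C_o ∈ 𝒟}`), every decoy list `D` and every
monotone `F`:  `0 ≤ Marg_{X,D}[o ↦ ∫_{o↔X} (F(C o) − F(C c)), u ↦ ∫_{P ∩ {u↔X}} (F(C u) − F(C c))]` with the pocket constants.
[cite: KozmaNitzan2024, Question 8 (§5.5 p. 36), Conj. 4 (p. 32)] [cite: VandenbergHaggstromKahn2005, Thm. 1.3 (p. 6)] -/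
theorem preMargin_nonneg_of_pcsh (w : Sym2 (Fin n) → unitInterval) (hw : ∀ e, w e < 1) (o v : Fin n)
    (𝒟 : Set (Set (Fin n))) (h𝒟o : ({o} : Set (Fin n)) ∈ 𝒟)
    (hPCSH : ∀ (x : Fin n) (Y : Finset (Fin n)) (D : List (Fin n)),
      x ∉ Y → o ≠ x → v ≠ x → o ∉ Y → v ∉ Y → D.Nodup → (∀ d ∈ D, d ≠ x ∧ d ∉ Y ∧ d ≠ o ∧ d ≠ v) →
      PCSHHolds w o 𝒟 x (↑Y : Set (Fin n)) D v) :
    ∀ (X : Finset (Fin n)) (c : Fin n) (D : List (Fin n)) (F : Set (Fin n) → ℝ),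
      (∀ S S' : Set (Fin n), S ⊆ S' → F S ≤ F S') → c ∈ X →
      (∀ a ∈ X, ∫ ω in pocketEv o 𝒟, F (openCluster ω c) ∂(prodBernoulli w) ≤ ∫ ω in pocketEv o 𝒟, F (openCluster ω a) ∂(prodBernoulli w)) →
      o ∉ X → v ∉ X → D.Nodup → (∀ d ∈ D, d ∉ X ∧ d ≠ o ∧ d ≠ v) →
      0 ≤ cshMarg (pDecoyList w o 𝒟 (↑X : Set (Fin n)) D) (pObsConst w o 𝒟 v ((↑X : Set (Fin n)) ∪ {d | d ∈ D})) o v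
        (fun u => if u = o then ∫ ω in ⋃ a ∈ X, openConn o a, (F (openCluster ω o) - F (openCluster ω c)) ∂(prodBernoulli w)
          else ∫ ω in pocketEv o 𝒟 ∩ ⋃ a ∈ X, openConn u a, (F (openCluster ω u) - F (openCluster ω c)) ∂(prodBernoulli w)) := by
  classical
  have main : ∀ (N : ℕ) (X : Finset (Fin n)) (c : Fin n) (D : List (Fin n)) (F : Set (Fin n) → ℝ), X.card = N →
      (∀ S S' : Set (Fin n), S ⊆ S' → F S ≤ F S') → c ∈ X →
      (∀ a ∈ X, ∫ ω in pocketEv o 𝒟, F (openCluster ω c) ∂(prodBernoulli w) ≤ ∫ ω in pocketEv o 𝒟, F (openCluster ω a) ∂(prodBernoulli w)) →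
      o ∉ X → v ∉ X → D.Nodup → (∀ d ∈ D, d ∉ X ∧ d ≠ o ∧ d ≠ v) →
      0 ≤ cshMarg (pDecoyList w o 𝒟 (↑X : Set (Fin n)) D) (pObsConst w o 𝒟 v ((↑X : Set (Fin n)) ∪ {d | d ∈ D})) o v
        (fun u => if u = o then ∫ ω in ⋃ a ∈ X, openConn o a, (F (openCluster ω o) - F (openCluster ω c)) ∂(prodBernoulli w)
          else ∫ ω in pocketEv o 𝒟 ∩ ⋃ a ∈ X, openConn u a, (F (openCluster ω u) - F (openCluster ω c)) ∂(prodBernoulli w)) := by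
    intro N
    induction N using Nat.strong_induction_on with
    | _ N ih =>
    intro X c D F hN hF hcX hcmin hoX hvX hD hDX
    set μ := prodBernoulli w with hμ
    set P : Set (BondConfig (Fin n)) := pocketEv o 𝒟 with hP
    have hmeas : ∀ S : Set (BondConfig (Fin n)), MeasurableSet S := fun _ => MeasurableSet.of_discrete
    have hint : ∀ (g : BondConfig (Fin n) → ℝ), Integrable g μ := fun g => Integrable.of_finite
    have hn := fun (S : Set (BondConfig (Fin n))) => (measureReal_nonneg : 0 ≤ μ.real S)
    have hoc : o ≠ c := fun h => hoX (h ▸ hcX)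
    have hvc : v ≠ c := fun h => hvX (h ▸ hcX)
    -- the pocket pre-FKG surplus as a function of the relay set
    set PS : Finset (Fin n) → (Fin n → ℝ) := fun Y u =>
      if u = o then ∫ ω in ⋃ a ∈ Y, openConn o a, (F (openCluster ω o) - F (openCluster ω c)) ∂μ
      else ∫ ω in P ∩ ⋃ a ∈ Y, openConn u a, (F (openCluster ω u) - F (openCluster ω c)) ∂μ with hPS
    rcases (X.erase c).eq_empty_or_nonempty with h0 | hne
    · -- base: `X = {c}`, `Δ ≡ 0`
      have hXc : X = {c} := by
        rw [← Finset.insert_erase hcX, h0]; rfl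
      have hzero : PS X = fun _ => 0 := by
        funext u
        simp only [hPS, hXc]
        have hU : ∀ u' : Fin n, (⋃ a ∈ ({c} : Finset (Fin n)), (openConn u' a : Set (BondConfig (Fin n)))) = openConn u' c := by
          intro u'; ext ω; simp
        by_cases huo : u = o
        · rw [if_pos huo, hU]
          rw [setIntegral_congr_fun (hmeas _) (g := fun _ => (0 : ℝ)) (fun ω hω => by
            show F (openCluster ω o) - F (openCluster ω c) = 0
            rw [openCluster_eq_of_reach (show (openGraph ω).Reachable o c from hω), sub_self])]
          simp
        · rw [if_neg huo, hU]
          rw [setIntegral_congr_fun (hmeas _) (g := fun _ => (0 : ℝ)) (fun ω hω => by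
            show F (openCluster ω u) - F (openCluster ω c) = 0
            rw [openCluster_eq_of_reach (show (openGraph ω).Reachable u c from hω.2), sub_self])]
          simp
      show 0 ≤ cshMarg _ _ o v (PS X)
      rw [hzero]
      simp only [cshMarg]
      rw [show (fun _ : Fin n => (0 : ℝ)) = (0 : Fin n → ℝ) from rfl, slForm_zero]
      simp
    -- step: peel some `k ∈ X`, `k ≠ c`
    obtain ⟨k, hk⟩ := hne
    have hkc : k ≠ c := (Finset.mem_erase.1 hk).1
    have hkX : k ∈ X := (Finset.mem_erase.1 hk).2
    set X' : Finset (Fin n) := X.erase k with hX'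
    have hXcard : X'.card < N := by
      rw [hX', Finset.card_erase_of_mem hkX]; have := Finset.card_pos.2 ⟨k, hkX⟩; omega
    have hX'X : ∀ a ∈ X', a ∈ X := fun a ha => Finset.mem_of_mem_erase ha
    have hkX' : k ∉ X' := Finset.notMem_erase k X
    have hcX' : c ∈ X' := Finset.mem_erase.2 ⟨hkc.symm, hcX⟩
    have hko : o ≠ k := fun h => hoX (h ▸ hkX)
    have hkv : v ≠ k := fun h => hvX (h ▸ hkX)
    have hkD : k ∉ D := fun h => (hDX k h).1 hkX
    have hsk : ∫ ω in P, F (openCluster ω c) ∂μ ≤ ∫ ω in P, F (openCluster ω k) ∂μ := hcmin k hkX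
    -- the objects
    set Dk : Set (BondConfig (Fin n)) := {ω : BondConfig (Fin n) | ∀ a ∈ (↑X' : Set (Fin n)), ¬ (openGraph ω).Reachable k a}
      with hDk
    set gk : BondConfig (Fin n) → ℝ := fun ω => F (openCluster ω k) - F (openCluster ω c) with hgk
    set L := pDecoyList w o 𝒟 (↑X : Set (Fin n)) D with hL
    set p : ℝ := pObsConst w o 𝒟 v ((↑X : Set (Fin n)) ∪ {d | d ∈ D}) with hp
    set ck : Fin n → ℝ := pAvoidConst w o 𝒟 k (↑X' : Set (Fin n)) with hck
    set Tk : Fin n → ℝ := fun u => if u = o then ∫ ω in Dk ∩ openConn k o, gk ω ∂μ else ∫ ω in Dk ∩ P ∩ openConn k u, gk ω ∂μ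
      with hTk
    set R : ℝ := μ.real (Dk ∩ P) with hR
    set J : ℝ := ∫ ω in Dk ∩ P, gk ω ∂μ with hJ
    -- positivity of the reference events (weights `< 1`, `{o} ∈ 𝒟`)
    have hempty_Dk : (∅ : BondConfig (Fin n)) ∈ Dk := by
      intro a ha h
      rw [KnQ8.reachable_empty_iff] at h
      exact hkX' (h ▸ (Finset.mem_coe.1 ha))
    have hempty_P : (∅ : BondConfig (Fin n)) ∈ P := by
      show openCluster (∅ : BondConfig (Fin n)) o ∈ 𝒟
      have hco : openCluster (∅ : BondConfig (Fin n)) o = {o} := by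
        ext y; simp only [openCluster, mem_setOf_eq, KnQ8.reachable_empty_iff, mem_singleton_iff, eq_comm]
      rw [hco]; exact h𝒟o
    have hRpos : 0 < R := KnQ8.real_pos_of_empty_mem w hw ⟨hempty_Dk, hempty_P⟩
    have hisopos : 0 < μ.real (Dk ∩ P ∩ {ω | openEdgeCluster ω k = ∅}) :=
      KnQ8.real_pos_of_empty_mem w hw ⟨⟨hempty_Dk, hempty_P⟩, subset_empty_iff.1 (openEdgeCluster_subset ∅ k)⟩
    -- set identities between the systems `(X; D)`, `(X'; k; D)` and `(X'; k :: D)`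
    have hins : insert k (↑X' : Set (Fin n)) = ↑X := by
      rw [hX', Finset.coe_erase, insert_sdiff_singleton, insert_eq_of_mem (Finset.mem_coe.2 hkX)]
    have hset2 : (↑X' : Set (Fin n)) ∪ {d | d ∈ k :: D} = (↑X : Set (Fin n)) ∪ {d | d ∈ D} := by
      ext a
      simp only [mem_union, Finset.mem_coe, hX', Finset.mem_erase, mem_setOf_eq, List.mem_cons]
      constructor
      · rintro (⟨_, ha⟩ | rfl | ha)
        · exact Or.inl ha
        · exact Or.inl hkX
        · exact Or.inr ha
      · rintro (ha | ha)
        · by_cases hak : a = k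
          · exact Or.inr (Or.inl hak)
          · exact Or.inl ⟨hak, ha⟩
        · exact Or.inr (Or.inr ha)
    have hpcshMargin : ∀ g : BondConfig (Fin n) → ℝ,
        pcshMargin w o 𝒟 k (↑X' : Set (Fin n)) D v g = cshMarg L p o v (pCovD w o 𝒟 k (↑X' : Set (Fin n)) g) := by
      intro g
      rw [pcshMargin, hins]
    have hnext : cshMarg (pDecoyList w o 𝒟 (↑X' : Set (Fin n)) (k :: D)) (pObsConst w o 𝒟 v ((↑X' : Set (Fin n)) ∪ {d | d ∈ k :: D})) o v
        (PS X') = cshMarg L p o v (PS X') - PS X' k * cshMarg L p o v ck := by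
      rw [hset2, pDecoyList_cons, hins, cshMarg_cons]
    -- (1) peel `k` (plain at `o`, inside the pocket event elsewhere)
    have hpeel : PS X = PS X' + Tk := by
      funext u
      rw [Pi.add_apply]
      by_cases huo : u = o
      · simp only [hPS, hTk, if_pos huo]
        exact preSurplus_erase_add w X F c k o hkX
      · simp only [hPS, hTk, if_neg huo]
        rw [setIntegral_iUnion_erase_add w X F c k u hkX P,
          show P ∩ ({ω : BondConfig (Fin n) | ∀ a ∈ (↑(X.erase k) : Set (Fin n)), ¬ (openGraph ω).Reachable k a} ∩ openConn k u) =
            Dk ∩ P ∩ openConn k u from by rw [hDk, hX', ← inter_assoc, inter_comm P]]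
    -- (2) the peeled column through `pCovD`:  `R • Tk = pCovD(gk) + J • (R • ck)`
    have hA : ∀ u : Fin n, u ≠ o → μ.real (Dk ∩ P ∩ openConn k u) = R * ck u := by
      intro u hu
      have hcu : ck u = μ.real (Dk ∩ P ∩ openConn k u) / R := by
        simp only [hck, pAvoidConst, if_neg hu, hDk, hR, hP, hμ]
      rw [hcu, mul_div_cancel₀ _ (ne_of_gt hRpos)]
    have hAo : μ.real (Dk ∩ openConn k o) = R * ck o := by
      have hco : ck o = μ.real (Dk ∩ openConn k o) / R := by
        simp only [hck, pAvoidConst, if_true, hDk, hR, hP, hμ]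
      rw [hco, mul_div_cancel₀ _ (ne_of_gt hRpos)]
    have hTk_cov : R • Tk = pCovD w o 𝒟 k (↑X' : Set (Fin n)) gk + J • (R • ck) := by
      funext u
      simp only [Pi.add_apply, Pi.smul_apply, smul_eq_mul]
      by_cases huo : u = o
      · rw [huo, pCovD_obs]
        simp only [hTk, if_true]
        rw [← hDk, ← hP, ← hR, ← hJ, hAo]
        ring
      · rw [pCovD_of_ne w o 𝒟 k _ gk huo]
        simp only [hTk, if_neg huo]
        rw [← hDk, ← hP, ← hR, ← hJ, hA u huo]
        ring
    -- the total `J = s_k − Δ^P_k(X')`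
    have hJtot : J = ((∫ ω in P, F (openCluster ω k) ∂μ) - ∫ ω in P, F (openCluster ω c) ∂μ) - PS X' k := by
      have hPk : PS X' k = ∫ ω in P ∩ ⋃ a ∈ X', openConn k a, gk ω ∂μ := by
        simp only [hPS, if_neg hko.symm]
        rfl
      have hDkc : Dkᶜ = ⋃ a' ∈ X', (openConn k a' : Set (BondConfig (Fin n))) := by
        ext ω
        rw [mem_iUnion_openConn, mem_compl_iff, hDk]
        simp only [mem_setOf_eq, Finset.mem_coe, not_forall, not_not, exists_prop]
      have h1 := integral_inter_add_sdiff (μ := μ) (s := P) (hmeas Dk) ((hint gk).integrableOn)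
      have hsd : P \ Dk = P ∩ ⋃ a' ∈ X', (openConn k a' : Set (BondConfig (Fin n))) := by
        rw [← hDkc]; ext ω; simp only [mem_sdiff, mem_inter_iff, mem_compl_iff]
      rw [hsd, inter_comm P Dk] at h1
      have h3 : ∫ ω in P, gk ω ∂μ = (∫ ω in P, F (openCluster ω k) ∂μ) - ∫ ω in P, F (openCluster ω c) ∂μ := by
        rw [hgk, integral_sub (hint _).integrableOn (hint _).integrableOn]
      rw [hJ, hPk]; linarith
    -- (3) PCSH (i) for the peeled relay, integrand `gk` (`c ∈ X'`)
    have hPk := hPCSH k X' D hkX' hko hkv (fun h => hoX (hX'X o h)) (fun h => hvX (hX'X v h)) hD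
      (fun d hd => ⟨fun h => hkD (h ▸ hd), fun h => (hDX d hd).1 (hX'X d h), (hDX d hd).2.1, (hDX d hd).2.2⟩)
    have h3 : 0 ≤ cshMarg L p o v (pCovD w o 𝒟 k (↑X' : Set (Fin n)) gk) := by
      rw [← hpcshMargin]
      exact hPk.1 F hF c (Finset.mem_coe.2 hcX')
    -- (4) Lemma AC: `Marg[c_k] ≥ 0` from PCSH (ii) at `Ψ_iso`
    have h4 : 0 ≤ cshMarg L p o v ck := by
      have hiso := hPk.2 psiIso psiIso_mono
      rw [hpcshMargin] at hiso
      have hLk : ∀ dc ∈ L, dc.1 ≠ k := fun dc hdc h => hkD (h ▸ mem_pDecoyList w o 𝒟 _ D dc hdc)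
      -- `∫_{S ∩ {k↔u}} Ψ_iso(C_k) = μ(S ∩ {k↔u})` for `u ≠ k`, and `∫_{R} Ψ_iso = R − μ(R ∩ {C_k = ∅})`
      have hone : ∀ (S : Set (BondConfig (Fin n))) (u : Fin n), u ≠ k →
          ∫ ω in S ∩ openConn k u, psiIso (openEdgeCluster ω k) ∂μ = μ.real (S ∩ openConn k u) := by
        intro S u huk
        rw [setIntegral_congr_fun (hmeas _) (fun ω hω => psiIso_eq_one_of_reachable huk hω.2), setIntegral_const, smul_eq_mul,
          mul_one]
      have htwo : ∫ ω in Dk ∩ P, psiIso (openEdgeCluster ω k) ∂μ = R - μ.real (Dk ∩ P ∩ {ω | openEdgeCluster ω k = ∅}) := by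
        have hsplit := (integral_inter_add_sdiff (hmeas {ω : BondConfig (Fin n) | openEdgeCluster ω k = ∅})
          ((hint (fun ω => psiIso (openEdgeCluster ω k))).integrableOn (s := Dk ∩ P))).symm
        rw [hsplit]
        have ha : ∫ ω in Dk ∩ P ∩ {ω | openEdgeCluster ω k = ∅}, psiIso (openEdgeCluster ω k) ∂μ = 0 := by
          rw [setIntegral_congr_fun (hmeas _) (g := fun _ => (0 : ℝ)) (fun ω hω => by
            have h0 : openEdgeCluster ω k = ∅ := hω.2
            show psiIso (openEdgeCluster ω k) = (0 : ℝ)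
            simp [psiIso, h0])]
          simp
        have hb : ∫ ω in (Dk ∩ P) \ {ω | openEdgeCluster ω k = ∅}, psiIso (openEdgeCluster ω k) ∂μ =
            μ.real ((Dk ∩ P) \ {ω | openEdgeCluster ω k = ∅}) := by
          rw [setIntegral_congr_fun (hmeas _) (g := fun _ => (1 : ℝ)) (fun ω hω => by
            show psiIso (openEdgeCluster ω k) = (1 : ℝ)
            simp only [psiIso, if_neg (show openEdgeCluster ω k ≠ ∅ from hω.2)])]
          simp
        rw [ha, hb, zero_add, hR]
        have := measureReal_inter_add_sdiff (μ := μ) (s := Dk ∩ P) (hmeas {ω : BondConfig (Fin n) | openEdgeCluster ω k = ∅})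
        linarith
      rw [cshMarg_congr L p o v (pCovD w o 𝒟 k (↑X' : Set (Fin n)) (fun ω => psiIso (openEdgeCluster ω k)))
        ((μ.real (Dk ∩ P ∩ {ω | openEdgeCluster ω k = ∅}) * R) • ck) (fun u => u ≠ k) hLk hko hkv
        (fun u hu => by
          rw [Pi.smul_apply, smul_eq_mul]
          by_cases huo : u = o
          · rw [huo, pCovD_obs, ← hDk, ← hP, ← hR, hone Dk o hko, htwo, hAo]
            ring
          · rw [pCovD_of_ne w o 𝒟 k _ _ huo, ← hDk, ← hP, ← hR, hone (Dk ∩ P) u hu, htwo, hA u huo]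
            ring), cshMarg_smul] at hiso
      exact (mul_nonneg_iff_of_pos_left (mul_pos hisopos hRpos)).1 hiso
    -- (5) the designation: `J ≥ −Δ^P_k(X')`
    have h5 : -PS X' k ≤ J := by rw [hJtot]; linarith [hsk]
    -- (6) the next rung by induction
    have h6 : 0 ≤ cshMarg (pDecoyList w o 𝒟 (↑X' : Set (Fin n)) (k :: D)) (pObsConst w o 𝒟 v ((↑X' : Set (Fin n)) ∪ {d | d ∈ k :: D})) o v
        (PS X') :=
      ih X'.card hXcard X' c (k :: D) F rfl hF hcX' (fun a ha => hcmin a (hX'X a ha)) (fun h => hoX (hX'X o h)) (fun h => hvX (hX'X v h))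
        (List.nodup_cons.2 ⟨hkD, hD⟩)
        (fun d hd => by
          rcases List.mem_cons.1 hd with rfl | hd
          · exact ⟨hkX', hko.symm, hkv.symm⟩
          · exact ⟨fun h => (hDX d hd).1 (hX'X d h), (hDX d hd).2.1, (hDX d hd).2.2⟩)
    -- (7) assemble
    have hmain : R * cshMarg L p o v (PS X) =
        R * cshMarg L p o v (PS X') + cshMarg L p o v (pCovD w o 𝒟 k (↑X' : Set (Fin n)) gk) + J * R * cshMarg L p o v ck := by
      have e1 : R * cshMarg L p o v Tk = cshMarg L p o v (pCovD w o 𝒟 k (↑X' : Set (Fin n)) gk) + J * R * cshMarg L p o v ck := by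
        rw [← cshMarg_smul, hTk_cov, cshMarg_add, cshMarg_smul, cshMarg_smul]; ring
      rw [hpeel, cshMarg_add, mul_add, e1]
      ring
    have hbound : R * cshMarg (pDecoyList w o 𝒟 (↑X' : Set (Fin n)) (k :: D))
        (pObsConst w o 𝒟 v ((↑X' : Set (Fin n)) ∪ {d | d ∈ k :: D})) o v (PS X') ≤ R * cshMarg L p o v (PS X) := by
      rw [hmain, hnext]
      have := mul_le_mul_of_nonneg_right h5 (mul_nonneg hRpos.le h4)
      nlinarith [h3, h4, this, hRpos.le]
    show 0 ≤ cshMarg L p o v (PS X)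
    exact le_of_mul_le_mul_left (by linarith [mul_nonneg hRpos.le h6]) hRpos
  intro X c D F hF hcX hcmin hoX hvX hD hDX
  exact main X.card X c D F rfl hF hcX hcmin hoX hvX hD hDX

end PocketCSH

end Summit.CriticalPhenomena.PercolationContinuityZ3.Theorems

end
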